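import Summits.QuantumFields.BalabanUV.T4Continuum.Support.NE7SliceIterationStateFactsNL
import Summits.QuantumFields.BalabanUV.T4Continuum.Support.NE7SquaredBumpGradient
import Summits.QuantumFields.BalabanUV.T4Continuum.Support.NE3CurlOfGaugeDir
import Summits.QuantumFields.BalabanUV.T4Continuum.Support.NE7RightInverseLinear
import Summits.QuantumFields.BalabanUV.T4Continuum.Support.NE3RightInverseLetters
import Summits.QuantumFields.BalabanUV.T4Continuum.Support.NE3CovariantBlockMean
import HarnessLib

/-!
# NE7FrameFreeRightInverse — A RIGHT INVERSE OF THE LINEARISED k-FOLD AVERAGE WITH IDENTICALLY VANISHING ACCUMULATED FRAME (memo ROAD-G103 §6, repair (R1″)):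
# `R₀ φ := R_W φ + gaugeDir W (sfixW (framePotW (R_W φ)))` has `dirIter R₀ φ = φ` AND `framePotW R₀ φ = 0` EXACTLY, with the sup ∕ curl letters of `R_W` up to k-free constants

Cell `pub-balaban`, rung (B)+1 sub-cell t4, lineage `b2b-balaban-t4-ne7-p1`, generation 103 (CRUX PROVER NE7 #1 = OWNER of BINDER row NE7).  Memo `t4/b2b-balaban-t4-ne7-p1-g103/ROAD-G103.md` §6
(FINDING-2 and (R1″)).  WHY.  The (R1′) engine (`NE7SliceTheoremNL.slice_theorem_nl`) converges to a state with `mlog v_{k+1}(X⋆) = h⋆ + framePotW Ñ⋆`, `Ñ⋆ = R_W φ̃⋆` (row NE3's smooth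
right inverse `NE3SmoothRightInverseW.rightInvW`): the residual frame `framePotW Ñ⋆` keeps the double-bar average `U̿′^{k+1}` of [Balaban1985Averaging] (91)∕(92) away from `1`
(`NE7SliceDoubleBar.dbavgCovIter_state_eq_one_iff`), so the k-free letters of [Balaban1985RegularSpaces] §1 (tree: `Spine/NE3/RemainderTowerB8.sqrt_l2sq_QbarIter_le`,
`RemainderL1FinalB8.dirL1_QbarIter_le_quadratic`, hypothesis `hdbar : dbavgCovIter … = 1`) do not apply verbatim.  THE REPAIR is kinematic: replace `R_W` by the FRAME-FREE right
inverse `R₀` of this file — the same engine then converges to `mlog v_{k+1}(X⋆) = h⋆` EXACTLY ((1.37): the accumulated nonlinear frame IS the corner transformation), whence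
`U̿′^{k+1}(X⋆) = 1` and the B8 letters bite on `φ̃⋆ = QbarIter X⋆`.
THE CONSTRUCTION.  `μ := sfixW (framePotW L (k+1) W (R_W φ))` — the squared-tent nested-mean fix of `NE7SquaredBumpNestedFix` (an EXACT right inverse of `bmeanIterW`, vanishing at the
top corners since the tent does) — and `R₀ φ := R_W φ + gaugeDir W μ`.  Then `framePotW (gaugeDir W μ) z = μ(M•z) − bmeanIterW μ z = 0 − framePotW (R_W φ) z`
(`NE3CovariantBlockMean.framePotW_gaugeDir`) and `dirIter (gaugeDir W μ) = gaugeDir_V (μ ∘ M•) = 0` (`NE3TangentCovariantTower.dirIter_gaugeDir`).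
WHAT ([folklore]; 2 defs `frameLift`, `rightInvW0`, 1 constant pair `supC0`, `supCurlC0`; 0 sorry).
§1 `frameLift` (= `μ`): skew, `(tower)`-periodic, ZERO AT THE TOP CORNERS, sup `≤ 2·64^d·frameC·M·‖R_W φ‖_∞`, `‖gaugeDir W μ‖ ≤ 4d·64^d·frameC·supC∕(M(1−θ))·‖φ‖_∞`.
§2 `rightInvW0`: **`dirIter_rightInvW0`** (`= φ`), **`framePotW_rightInvW0`** (`= 0`), `isSkewDir_rightInvW0`, `isPeriodicDir_rightInvW0`, **`norm_rightInvW0_le`**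
   (`≤ supC0∕(M(1−θ))·s`, `supC0 = supC·(1 + 4d·64^d·frameC)`), **`norm_curlAt_rightInvW0_le`** (`≤ supCurlC0∕(M²(1−θ))·s`, `supCurlC0 = supCurlC + 4·64^d·frameC·supC`),
   `rightInvW0_sub` (linearity, for the continuity half).
HONEST FRAMING (page 1): linear kinematics at ONE background over landed kernel theorems; nothing of Bałaban's asserted; NOT (S1), NOT NE7; spine 0∕9; finite T⁴ rung (B)+1 — NOT infinite
volume, NOT mass gap, NOT BetaPertH, NOT Clay (continuum YM on T⁴ ⇐ BetaPertH ∧ nine spine estimates, 0/9 proved).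
-/

set_option autoImplicit false

open scoped BigOperators Matrix.Norms.L2Operator
open NormedSpace Finset

namespace Summit.QuantumFields.BalabanUV.T4Continuum.NE7FrameFreeRightInverse

open Literature.MathematicalPhysics.QuantumFieldTheory.Balaban1983to89
open B7Prop1Explicit B7Prop2Explicit MatrixLog
open T4AveragingDeficitWall (IsUnitaryCfg IsSkewDir SmallField Ad curlAt)
open T4AveragingDeficitNonAbelian (Ad_sub)
open AveragingDeficitNearIdentity (Ad_zero Ad_real_smul)
open T4AveragingDeficitWallBoundary (IsPeriodicCfg periodBox mem_periodBox)
open AveragingDeficitPeriodicCounting (IsPeriodicDir)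
open AveragingDeficitTwoLevelPrep (prop1Radius)
open AveragingDeficitMultiLevelPrep (cavgIter LevelSmall tower)
open BlockAveragePushDirGauge (gaugeDir)
open NE3RightInverseSupLetters (frameC supC norm_rightInvW_le norm_framePotW_le_of_sup)
open NE3HatInvCurlLetters (supCurlC)
open NE3QbarIterCovLiftPrep (cruxC)
open NE3SmoothRightInverseW (rightInvW dirIter_rightInvW isSkewDir_rightInvW isPeriodicDir_rightInvW)
open NE3RightInverseLetters (norm_curl_rightInvW_le)
open NE7RightInverseLinear (rightInvW_sub)
open NE3TangentCovariantTower (dirIter framePotW dirIter_add dirIter_gaugeDir)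
open NE3CovariantBlockMean (bmeanIterW framePotW_gaugeDir)
open NE3CurvedFrameKill (framePotW_add)
open NE3SmoothLiftW (framePotW_skew framePotW_add_period)
open NE3LandauOrbit (gaugeDir_skew)
open NE3CurlOfGaugeDir (norm_curlAt_gaugeDir_le curlAt_sub)
open NE3EnergyHessBilin (curlAt_add)
open NE7SliceStepErrorField (norm_curlAt_le_of_plaq)
open NE7SliceFrameMatchingLimit (framePotW_sub)
open NE7SquaredBumpNestedFix (sfixW sfixCoef bmeanIterW_sfixW sfixW_mem_skewAdjoint sfixW_add_period norm_sfixW_le norm_sfixW_le_of_sup norm_sfixCoef_le_of_sup)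
open NE7SquaredBumpGradient (norm_gaugeDir_dressW_bump2_le)
open NE3TentBump (tent tent_eq_zero_of_res_eq_zero)
open NE3SquaredTentBump (bump2)
open NE3DressedBlockField (dressW)
open SmoothRefineBlocks (blk res blk_add_res blk_res_smul res_nonneg res_lt)
open SpreadLift (loopRad)

noncomputable section

variable {d : ℕ} {n : Type*} [Fintype n] [DecidableEq n]

/-- the sup constant of `R₀`: `supC·(1 + 4d·64^d·frameC)`. [folklore] -/
def supC0 (d L : ℕ) : ℝ := supC d L * (1 + 4 * (d : ℝ) * (64 : ℝ) ^ d * frameC d L)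

/-- the curl constant of `R₀`: `supCurlC + 4·64^d·frameC·supC`. [folklore] -/
def supCurlC0 (d L : ℕ) : ℝ := supCurlC d L + 4 * (64 : ℝ) ^ d * frameC d L * supC d L

/-- `0 ≤ frameC`. [folklore] -/
theorem frameC_nonneg (d L : ℕ) : 0 ≤ frameC d L := by unfold frameC; positivity

/-- `0 ≤ supC`. [folklore] -/
theorem supC_nonneg (d L : ℕ) : 0 ≤ supC d L := by
  unfold supC
  have h1 := NE3QbarIterCovLiftPrep.liftC_nonneg d
  have h2 : 1 ≤ NE3RightInverseSupLetters.corrC d := NE3RightInverseSupLetters.one_le_corrC d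
  have h3 := frameC_nonneg d L
  have : 0 ≤ NE3RightInverseSupLetters.corrC d := by linarith
  positivity

/-- `supC ≤ supC0`. [folklore] -/
theorem supC_le_supC0 (d L : ℕ) : supC d L ≤ supC0 d L := by
  unfold supC0
  have h0 : 0 ≤ supC d L := supC_nonneg d L
  have h1 : 0 ≤ frameC d L := frameC_nonneg d L
  nlinarith [mul_nonneg h0 (show (0 : ℝ) ≤ 4 * (d : ℝ) * (64 : ℝ) ^ d * frameC d L by positivity)]

/-- `0 ≤ supC0`. [folklore] -/
theorem supC0_nonneg (d L : ℕ) : 0 ≤ supC0 d L := by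
  unfold supC0; have := supC_nonneg d L; have := frameC_nonneg d L; positivity

section RightInverse

variable [Nonempty n] {L : ℕ} (hL : 2 ≤ L) (k : ℕ) {W : Site d → Fin d → (Matrix n n ℂ)ˣ} {x : ℝ} (hWu : IsUnitaryCfg W) (hx : 0 ≤ x) (hs : LevelSmall d L k x)
  (hWx : SmallField W x) (N : ℕ) [NeZero N] (hθ : cruxC d L * (((L : ℝ) ^ (k + 1)) ^ 2 * x) < 1)
  (hE : 4 * (d : ℝ) ^ 2 * ((L : ℝ) ^ (k + 1) - 1) ^ 2 * x + 16 * d * loopRad d L ((prop1Radius d L)^[k] x) ≤ 1 / 2)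

/-! ## §1 The frame lift `μ = sfixW (framePotW (R_W φ))` -/

/-- **THE FRAME LIFT**: the squared-tent nested-mean fix of the accumulated linearised frame of `R_W φ`. [folklore] -/
def frameLift {φ : Site d → Fin d → Matrix n n ℂ} (hφ : IsSkewDir φ) : Site d → Matrix n n ℂ :=
  sfixW hL k hWu hx hs hWx hE (framePotW L (k + 1) W (rightInvW hL k hWu hx hs hWx N hθ hφ))

/-- **THE FRAME-FREE RIGHT INVERSE** `R₀ φ := R_W φ + gaugeDir W (frameLift φ)`. [folklore] -/
def rightInvW0 {φ : Site d → Fin d → Matrix n n ℂ} (hφ : IsSkewDir φ) : Site d → Fin d → Matrix n n ℂ :=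
  fun y ν => rightInvW hL k hWu hx hs hWx N hθ hφ y ν + gaugeDir W (frameLift hL k hWu hx hs hWx N hθ hE hφ) y ν

variable {φ : Site d → Fin d → Matrix n n ℂ} (hφ : IsSkewDir φ)

/-- the frame datum `framePotW (R_W φ)` is skew. [folklore] -/
theorem framePotW_rightInvW_skew (z : Site d) :
    framePotW L (k + 1) W (rightInvW hL k hWu hx hs hWx N hθ hφ) z ∈ skewAdjoint (Matrix n n ℂ) :=
  framePotW_skew (by omega) k hWu hx hs hWx (isSkewDir_rightInvW hL k hWu hx hs hWx hθ hφ) z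

/-- the frame datum is `N`-periodic (`W` `(tower)`-periodic). [folklore] -/
theorem framePotW_rightInvW_add_period (hWP : IsPeriodicCfg W ((tower L N (k + 1) : ℕ) : ℤ)) (z : Site d) (i : Fin d) :
    framePotW L (k + 1) W (rightInvW hL k hWu hx hs hWx N hθ hφ) (z + (N : ℤ) • e i)
      = framePotW L (k + 1) W (rightInvW hL k hWu hx hs hWx N hθ hφ) z :=
  framePotW_add_period L k hWP (isPeriodicDir_rightInvW hL k hWu hWP hx hs hWx hθ hφ) z i

/-- the frame lift is skew. [folklore] -/
theorem frameLift_skew (y : Site d) : frameLift hL k hWu hx hs hWx N hθ hE hφ y ∈ skewAdjoint (Matrix n n ℂ) :=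
  sfixW_mem_skewAdjoint hL k hWu hx hs hWx hE (framePotW_rightInvW_skew hL k hWu hx hs hWx N hθ hφ) y

/-- the frame lift is `(tower)`-periodic. [folklore] -/
theorem frameLift_add_period (hWP : IsPeriodicCfg W ((tower L N (k + 1) : ℕ) : ℤ)) (y : Site d) (i : Fin d) :
    frameLift hL k hWu hx hs hWx N hθ hE hφ (y + ((tower L N (k + 1) : ℕ) : ℤ) • e i) = frameLift hL k hWu hx hs hWx N hθ hE hφ y :=
  sfixW_add_period hL k hWu hx hs hWx hE hWP (framePotW_rightInvW_add_period hL k hWu hx hs hWx N hθ hφ hWP) y i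

/-- **THE FRAME LIFT VANISHES AT THE TOP CORNERS** (the squared tent does). [folklore] -/
theorem frameLift_corner (i₀ : Fin d) (z : Site d) : frameLift hL k hWu hx hs hWx N hθ hE hφ (((L : ℤ) ^ (k + 1)) • z) = 0 := by
  have hM1 : 1 ≤ L ^ (k + 1) := Nat.one_le_pow _ _ (by omega)
  have hc : ((L : ℤ) ^ (k + 1)) = ((L ^ (k + 1) : ℕ) : ℤ) := by push_cast; ring
  have hres : res (L ^ (k + 1)) (((L : ℤ) ^ (k + 1)) • z) i₀ = 0 := by
    rw [hc, (blk_res_smul hM1 z).2]; rfl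
  have ht : tent (L ^ (k + 1)) (((L : ℤ) ^ (k + 1)) • z) = 0 := tent_eq_zero_of_res_eq_zero hres
  have h := norm_sfixW_le hL k hWu hx hs hWx hE (framePotW L (k + 1) W (rightInvW hL k hWu hx hs hWx N hθ hφ)) (((L : ℤ) ^ (k + 1)) • z)
  rw [ht] at h
  have h0 : ‖frameLift hL k hWu hx hs hWx N hθ hE hφ (((L : ℤ) ^ (k + 1)) • z)‖ ≤ 0 := by
    unfold frameLift; simpa using h
  exact norm_le_zero_iff.1 h0

/-- **SUP OF THE FRAME LIFT**: `‖φ‖_∞ ≤ s` ⇒ `‖μ y‖ ≤ 2·64^d·(frameC·M·(supC∕(M(1−θ))·s))`. [folklore] -/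
theorem norm_frameLift_le (hε : ((L : ℝ) ^ (k + 1)) ^ 2 * x ≤ 1) {s : ℝ} (hs0 : 0 ≤ s) (hφs : ∀ (z : Site d) (κ : Fin d), ‖φ z κ‖ ≤ s) (y : Site d) :
    ‖frameLift hL k hWu hx hs hWx N hθ hE hφ y‖
      ≤ 2 * (64 : ℝ) ^ d * (frameC d L * (L : ℝ) ^ (k + 1) * (supC d L / ((L : ℝ) ^ (k + 1) * (1 - cruxC d L * (((L : ℝ) ^ (k + 1)) ^ 2 * x))) * s)) := by
  have hpos : 0 < 1 - cruxC d L * (((L : ℝ) ^ (k + 1)) ^ 2 * x) := by linarith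
  have hN0 : 0 ≤ supC d L / ((L : ℝ) ^ (k + 1) * (1 - cruxC d L * (((L : ℝ) ^ (k + 1)) ^ 2 * x))) * s := by
    have := supC_nonneg d L; positivity
  have hF : ∀ z, ‖framePotW L (k + 1) W (rightInvW hL k hWu hx hs hWx N hθ hφ) z‖
      ≤ frameC d L * (L : ℝ) ^ (k + 1) * (supC d L / ((L : ℝ) ^ (k + 1) * (1 - cruxC d L * (((L : ℝ) ^ (k + 1)) ^ 2 * x))) * s) := fun z =>
    norm_framePotW_le_of_sup hL k hWu hx hs hWx _ hN0 (norm_rightInvW_le hL k hWu hx hs hWx N hθ hε hφ hs0 hφs) z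
  exact (norm_sfixW_le_of_sup hL k hWu hx hs hWx hE _ hF y).2

/-- **SUP OF THE GAUGE DIRECTION OF THE FRAME LIFT**: `‖gaugeDir W μ (y, ν)‖ ≤ 4d·64^d·frameC·(supC∕(M(1−θ)))·s` (the tent's `2∕M` slope and the comb defect `2(d−1)(M−1)x`, times
`M` from the frame letter; `M²x ≤ 1`). [folklore] -/
theorem norm_gaugeDir_frameLift_le (hε : ((L : ℝ) ^ (k + 1)) ^ 2 * x ≤ 1) {s : ℝ} (hs0 : 0 ≤ s) (hφs : ∀ (z : Site d) (κ : Fin d), ‖φ z κ‖ ≤ s)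
    (y : Site d) (ν : Fin d) :
    ‖gaugeDir W (frameLift hL k hWu hx hs hWx N hθ hE hφ) y ν‖
      ≤ 4 * (d : ℝ) * (64 : ℝ) ^ d * frameC d L * (supC d L / ((L : ℝ) ^ (k + 1) * (1 - cruxC d L * (((L : ℝ) ^ (k + 1)) ^ 2 * x))) * s) := by
  have hM1 : 1 ≤ L ^ (k + 1) := Nat.one_le_pow _ _ (by omega)
  have hMr : ((L ^ (k + 1) : ℕ) : ℝ) = (L : ℝ) ^ (k + 1) := by push_cast; ring
  have hM0 : (0 : ℝ) < (L : ℝ) ^ (k + 1) := by positivity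
  have hMge : (1 : ℝ) ≤ (L : ℝ) ^ (k + 1) := one_le_pow₀ (by exact_mod_cast (by omega : 1 ≤ L))
  have hd1 : (1 : ℝ) ≤ d := by exact_mod_cast ν.pos
  have hpos : 0 < 1 - cruxC d L * (((L : ℝ) ^ (k + 1)) ^ 2 * x) := by linarith
  set A : ℝ := supC d L / ((L : ℝ) ^ (k + 1) * (1 - cruxC d L * (((L : ℝ) ^ (k + 1)) ^ 2 * x))) * s with hA
  have hA0 : 0 ≤ A := by rw [hA]; have := supC_nonneg d L; positivity
  have hfr0 : 0 ≤ frameC d L := frameC_nonneg d L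
  -- the coefficient of the squared bump
  have hF : ∀ z, ‖framePotW L (k + 1) W (rightInvW hL k hWu hx hs hWx N hθ hφ) z‖ ≤ frameC d L * (L : ℝ) ^ (k + 1) * A := fun z =>
    norm_framePotW_le_of_sup hL k hWu hx hs hWx _ hA0 (norm_rightInvW_le hL k hWu hx hs hWx N hθ hε hφ hs0 hφs) z
  have hc : ∀ z, ‖sfixCoef hL k hWu hx hs hWx hE (framePotW L (k + 1) W (rightInvW hL k hWu hx hs hWx N hθ hφ)) z‖
      ≤ 2 * (64 : ℝ) ^ d * (frameC d L * (L : ℝ) ^ (k + 1) * A) := fun z => norm_sfixCoef_le_of_sup hL k hWu hx hs hWx hE _ hF z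
  -- read the site through its block
  have hy : y = ((L ^ (k + 1) : ℕ) : ℤ) • blk (L ^ (k + 1)) y + res (L ^ (k + 1)) y := (blk_add_res (L ^ (k + 1)) y).symm
  have hv : res (L ^ (k + 1)) y ∈ periodBox (d := d) (L ^ (k + 1)) :=
    mem_periodBox.2 fun i => ⟨res_nonneg hM1 y i, res_lt hM1 y i⟩
  have h1 := norm_gaugeDir_dressW_bump2_le hM1 hWu hx hWx
    (sfixCoef hL k hWu hx hs hWx hE (framePotW L (k + 1) W (rightInvW hL k hWu hx hs hWx N hθ hφ))) (blk (L ^ (k + 1)) y) hv ν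
  rw [← hy, hMr] at h1
  have h2 : ‖gaugeDir W (frameLift hL k hWu hx hs hWx N hθ hE hφ) y ν‖
      ≤ (2 / (L : ℝ) ^ (k + 1) + 2 * (((d : ℝ) - 1) * ((L : ℝ) ^ (k + 1) - 1) * x)) * (2 * (64 : ℝ) ^ d * (frameC d L * (L : ℝ) ^ (k + 1) * A)) := by
    unfold frameLift sfixW
    refine h1.trans (mul_le_mul_of_nonneg_left (hc _) ?_)
    have : 0 ≤ ((d : ℝ) - 1) * ((L : ℝ) ^ (k + 1) - 1) * x := mul_nonneg (mul_nonneg (by linarith) (by linarith)) hx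
    positivity
  refine h2.trans ?_
  -- `(2/M + 2(d−1)(M−1)x)·M ≤ 2d` by `M²x ≤ 1`
  have hslope : (2 / (L : ℝ) ^ (k + 1) + 2 * (((d : ℝ) - 1) * ((L : ℝ) ^ (k + 1) - 1) * x)) * (L : ℝ) ^ (k + 1) ≤ 2 * d := by
    rw [add_mul, div_mul_cancel₀ _ hM0.ne']
    have h3 : ((L : ℝ) ^ (k + 1) - 1) * x * (L : ℝ) ^ (k + 1) ≤ 1 := by nlinarith
    nlinarith
  have hB0 : 0 ≤ 2 * (64 : ℝ) ^ d * (frameC d L * A) := by positivity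
  calc (2 / (L : ℝ) ^ (k + 1) + 2 * (((d : ℝ) - 1) * ((L : ℝ) ^ (k + 1) - 1) * x)) * (2 * (64 : ℝ) ^ d * (frameC d L * (L : ℝ) ^ (k + 1) * A))
        = ((2 / (L : ℝ) ^ (k + 1) + 2 * (((d : ℝ) - 1) * ((L : ℝ) ^ (k + 1) - 1) * x)) * (L : ℝ) ^ (k + 1)) * (2 * (64 : ℝ) ^ d * (frameC d L * A)) := by ring
    _ ≤ (2 * d) * (2 * (64 : ℝ) ^ d * (frameC d L * A)) := mul_le_mul_of_nonneg_right hslope hB0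
    _ = 4 * (d : ℝ) * (64 : ℝ) ^ d * frameC d L * A := by ring

/-! ## §2 The frame-free right inverse -/

/-- **`D_W R₀ φ = φ` EXACTLY** (`φ` skew `N`-periodic, `W` `(tower)`-periodic; `d ≥ 1`). [folklore] -/
theorem dirIter_rightInvW0 (hWP : IsPeriodicCfg W ((tower L N (k + 1) : ℕ) : ℤ)) (hφP : IsPeriodicDir φ (N : ℤ)) (i₀ : Fin d) :
    dirIter L (k + 1) W (rightInvW0 hL k hWu hx hs hWx N hθ hE hφ) = φ := by
  have hL1 : 1 ≤ L := by omega
  show dirIter L (k + 1) W (fun y ν => rightInvW hL k hWu hx hs hWx N hθ hφ y ν + gaugeDir W (frameLift hL k hWu hx hs hWx N hθ hE hφ) y ν) = φ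
  rw [dirIter_add hL1 k hWu hx hs hWx]
  funext z κ
  rw [dirIter_rightInvW hL k hWu hWP hx hs hWx hθ hφ hφP,
    dirIter_gaugeDir (M := N) hL1 k hWu hWP hx hs hWx (frameLift_skew hL k hWu hx hs hWx N hθ hE hφ) (frameLift_add_period hL k hWu hx hs hWx N hθ hE hφ hWP)]
  simp only [frameLift_corner hL k hWu hx hs hWx N hθ hE hφ i₀, gaugeDir, Ad_zero, sub_zero, add_zero]

/-- **`framePotW R₀ φ = 0` EXACTLY** (`W` `(tower)`-periodic; `d ≥ 1`). [folklore] -/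
theorem framePotW_rightInvW0 (hWP : IsPeriodicCfg W ((tower L N (k + 1) : ℕ) : ℤ)) (i₀ : Fin d) (z : Site d) :
    framePotW L (k + 1) W (rightInvW0 hL k hWu hx hs hWx N hθ hE hφ) z = 0 := by
  have hL1 : 1 ≤ L := by omega
  show framePotW L (k + 1) W (fun y ν => rightInvW hL k hWu hx hs hWx N hθ hφ y ν + gaugeDir W (frameLift hL k hWu hx hs hWx N hθ hE hφ) y ν) z = 0
  rw [framePotW_add hL1 k hWu hx hs hWx, framePotW_gaugeDir (M := N) hL1 k hWu hWP hx hs hWx (frameLift_skew hL k hWu hx hs hWx N hθ hE hφ)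
    (frameLift_add_period hL k hWu hx hs hWx N hθ hE hφ hWP) z, frameLift_corner hL k hWu hx hs hWx N hθ hE hφ i₀]
  unfold frameLift
  rw [bmeanIterW_sfixW]
  abel

/-- `R₀ φ` is skew. [folklore] -/
theorem isSkewDir_rightInvW0 : IsSkewDir (rightInvW0 hL k hWu hx hs hWx N hθ hE hφ) := fun y ν =>
  (skewAdjoint _).add_mem (isSkewDir_rightInvW hL k hWu hx hs hWx hθ hφ y ν) (gaugeDir_skew hWu (frameLift_skew hL k hWu hx hs hWx N hθ hE hφ) y ν)

/-- `R₀ φ` is `(tower)`-periodic. [folklore] -/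
theorem isPeriodicDir_rightInvW0 (hWP : IsPeriodicCfg W ((tower L N (k + 1) : ℕ) : ℤ)) :
    IsPeriodicDir (rightInvW0 hL k hWu hx hs hWx N hθ hE hφ) ((tower L N (k + 1) : ℕ) : ℤ) := by
  intro y i ν
  show rightInvW hL k hWu hx hs hWx N hθ hφ _ ν + gaugeDir W _ _ ν = rightInvW hL k hWu hx hs hWx N hθ hφ y ν + gaugeDir W _ y ν
  rw [isPeriodicDir_rightInvW hL k hWu hWP hx hs hWx hθ hφ y i ν,
    BlockAveragePushDirGauge.isPeriodicDir_gaugeDir hWP (frameLift_add_period hL k hWu hx hs hWx N hθ hE hφ hWP) y i ν]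

/-- **THE SUP LETTER**: `‖φ‖_∞ ≤ s` ⇒ `‖R₀ φ (y, ν)‖ ≤ supC0∕(M(1−θ))·s`. [folklore] -/
theorem norm_rightInvW0_le (hε : ((L : ℝ) ^ (k + 1)) ^ 2 * x ≤ 1) {s : ℝ} (hs0 : 0 ≤ s) (hφs : ∀ (z : Site d) (κ : Fin d), ‖φ z κ‖ ≤ s)
    (y : Site d) (ν : Fin d) :
    ‖rightInvW0 hL k hWu hx hs hWx N hθ hE hφ y ν‖ ≤ supC0 d L / ((L : ℝ) ^ (k + 1) * (1 - cruxC d L * (((L : ℝ) ^ (k + 1)) ^ 2 * x))) * s := by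
  have h1 := norm_rightInvW_le hL k hWu hx hs hWx N hθ hε hφ hs0 hφs y ν
  have h2 := norm_gaugeDir_frameLift_le hL k hWu hx hs hWx N hθ hE hφ hε hs0 hφs y ν
  refine (norm_add_le _ _).trans ((add_le_add h1 h2).trans (le_of_eq ?_))
  unfold supC0
  ring

/-- **THE CURL LETTER** (planes `μ ≠ ν`): `‖curlAt W (R₀ φ) z μ ν‖ ≤ supCurlC0∕(M²(1−θ))·s`. [folklore] -/
theorem norm_curlAt_rightInvW0_le (hε : ((L : ℝ) ^ (k + 1)) ^ 2 * x ≤ 1) {s : ℝ} (hs0 : 0 ≤ s) (hφs : ∀ (z : Site d) (κ : Fin d), ‖φ z κ‖ ≤ s)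
    (z : Site d) {μ ν : Fin d} (hμν : μ ≠ ν) :
    ‖curlAt W (rightInvW0 hL k hWu hx hs hWx N hθ hE hφ) z μ ν‖
      ≤ supCurlC0 d L / (((L : ℝ) ^ (k + 1)) ^ 2 * (1 - cruxC d L * (((L : ℝ) ^ (k + 1)) ^ 2 * x))) * s := by
  have hM0 : (0 : ℝ) < (L : ℝ) ^ (k + 1) := by positivity
  have hpos : 0 < 1 - cruxC d L * (((L : ℝ) ^ (k + 1)) ^ 2 * x) := by linarith
  have hfr0 : 0 ≤ frameC d L := frameC_nonneg d L
  have hsu0 : 0 ≤ supC d L := supC_nonneg d L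
  set A : ℝ := supC d L / ((L : ℝ) ^ (k + 1) * (1 - cruxC d L * (((L : ℝ) ^ (k + 1)) ^ 2 * x))) * s with hA
  have hA0 : 0 ≤ A := by rw [hA]; positivity
  have e : rightInvW0 hL k hWu hx hs hWx N hθ hE hφ = rightInvW hL k hWu hx hs hWx N hθ hφ + gaugeDir W (frameLift hL k hWu hx hs hWx N hθ hE hφ) := by
    funext y κ; rfl
  rw [e, curlAt_add]
  have h1 : ‖curlAt W (rightInvW hL k hWu hx hs hWx N hθ hφ) z μ ν‖
      ≤ supCurlC d L / (((L : ℝ) ^ (k + 1)) ^ 2 * (1 - cruxC d L * (((L : ℝ) ^ (k + 1)) ^ 2 * x))) * s :=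
    norm_curlAt_le_of_plaq hWu (fun p => norm_curl_rightInvW_le (N := N) hL k hWu hx hs hWx hθ hε hφ hs0 hφs p) z hμν
  have h2 : ‖curlAt W (gaugeDir W (frameLift hL k hWu hx hs hWx N hθ hE hφ)) z μ ν‖ ≤ 2 * x * (2 * (64 : ℝ) ^ d * (frameC d L * (L : ℝ) ^ (k + 1) * A)) :=
    (norm_curlAt_gaugeDir_le hWu hWx _ z hμν).trans
      (mul_le_mul_of_nonneg_left (norm_frameLift_le hL k hWu hx hs hWx N hθ hE hφ hε hs0 hφs z) (by positivity))
  refine (norm_add_le _ _).trans ((add_le_add h1 h2).trans ?_)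
  -- `2x·2·64^d·frameC·M·A ≤ 4·64^d·frameC·supC∕(M²(1−θ))·s` since `x·M·M² ≤ M` (`M²x ≤ 1`)
  have hx3 : x * (L : ℝ) ^ (k + 1) ≤ 1 / (L : ℝ) ^ (k + 1) := by
    rw [le_div_iff₀ hM0]; nlinarith
  have key : 2 * x * (2 * (64 : ℝ) ^ d * (frameC d L * (L : ℝ) ^ (k + 1) * A))
      ≤ 4 * (64 : ℝ) ^ d * frameC d L * supC d L / (((L : ℝ) ^ (k + 1)) ^ 2 * (1 - cruxC d L * (((L : ℝ) ^ (k + 1)) ^ 2 * x))) * s := by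
    have e1 : 2 * x * (2 * (64 : ℝ) ^ d * (frameC d L * (L : ℝ) ^ (k + 1) * A))
        = (x * (L : ℝ) ^ (k + 1)) * (4 * (64 : ℝ) ^ d * frameC d L * (supC d L / ((L : ℝ) ^ (k + 1) * (1 - cruxC d L * (((L : ℝ) ^ (k + 1)) ^ 2 * x))) * s)) := by
      rw [hA]; ring
    have e2 : 4 * (64 : ℝ) ^ d * frameC d L * supC d L / (((L : ℝ) ^ (k + 1)) ^ 2 * (1 - cruxC d L * (((L : ℝ) ^ (k + 1)) ^ 2 * x))) * s
        = (1 / (L : ℝ) ^ (k + 1)) * (4 * (64 : ℝ) ^ d * frameC d L * (supC d L / ((L : ℝ) ^ (k + 1) * (1 - cruxC d L * (((L : ℝ) ^ (k + 1)) ^ 2 * x))) * s)) := by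
      field_simp
    rw [e1, e2]
    exact mul_le_mul_of_nonneg_right hx3 (by positivity)
  refine (add_le_add le_rfl key).trans (le_of_eq ?_)
  unfold supCurlC0
  ring

/-- **LINEARITY** (for the continuity half): `R₀ (φ − ψ) = R₀ φ − R₀ ψ` pointwise. [folklore] -/
theorem rightInvW0_sub {ψ : Site d → Fin d → Matrix n n ℂ} (hψ : IsSkewDir ψ) (hφψ : IsSkewDir (fun y μ => φ y μ - ψ y μ)) (y : Site d) (ν : Fin d) :
    rightInvW0 hL k hWu hx hs hWx N hθ hE hφψ y ν = rightInvW0 hL k hWu hx hs hWx N hθ hE hφ y ν - rightInvW0 hL k hWu hx hs hWx N hθ hE hψ y ν := by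
  have hR : rightInvW hL k hWu hx hs hWx N hθ hφψ = fun y' ν' => rightInvW hL k hWu hx hs hWx N hθ hφ y' ν' - rightInvW hL k hWu hx hs hWx N hθ hψ y' ν' :=
    funext fun y' => funext fun ν' => rightInvW_sub hL k hWu hx hs hWx hθ hφ hψ hφψ y' ν'
  have hF : framePotW L (k + 1) W (rightInvW hL k hWu hx hs hWx N hθ hφψ)
      = fun z => framePotW L (k + 1) W (rightInvW hL k hWu hx hs hWx N hθ hφ) z - framePotW L (k + 1) W (rightInvW hL k hWu hx hs hWx N hθ hψ) z := by
    funext z; rw [hR, framePotW_sub hL k hWu hx hs hWx]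
  -- the fix is linear in its datum: `sfixCoef` is a linear map applied to the datum, the dressing is linear
  have hc : ∀ z, sfixCoef hL k hWu hx hs hWx hE (fun z' => framePotW L (k + 1) W (rightInvW hL k hWu hx hs hWx N hθ hφ) z'
        - framePotW L (k + 1) W (rightInvW hL k hWu hx hs hWx N hθ hψ) z') z
      = sfixCoef hL k hWu hx hs hWx hE (framePotW L (k + 1) W (rightInvW hL k hWu hx hs hWx N hθ hφ)) z
        - sfixCoef hL k hWu hx hs hWx hE (framePotW L (k + 1) W (rightInvW hL k hWu hx hs hWx N hθ hψ)) z := fun z => by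
    unfold sfixCoef; exact map_sub _ _ _
  have hμ : ∀ y', frameLift hL k hWu hx hs hWx N hθ hE hφψ y' = frameLift hL k hWu hx hs hWx N hθ hE hφ y' - frameLift hL k hWu hx hs hWx N hθ hE hψ y' := by
    intro y'
    unfold frameLift
    rw [hF]
    simp only [sfixW, dressW, bump2, hc, smul_sub, Ad_sub]
  show rightInvW hL k hWu hx hs hWx N hθ hφψ y ν + gaugeDir W (frameLift hL k hWu hx hs hWx N hθ hE hφψ) y ν
    = (rightInvW hL k hWu hx hs hWx N hθ hφ y ν + gaugeDir W (frameLift hL k hWu hx hs hWx N hθ hE hφ) y ν)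
      - (rightInvW hL k hWu hx hs hWx N hθ hψ y ν + gaugeDir W (frameLift hL k hWu hx hs hWx N hθ hE hψ) y ν)
  rw [hR]
  simp only [gaugeDir, hμ, Ad_sub]
  abel

end RightInverse

end

end Summit.QuantumFields.BalabanUV.T4Continuum.NE7FrameFreeRightInverse
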